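import Summits.SmoothPoincare4.SmoothPoincare4.Theorems.ConvexBisectionSteinBisectionExistsOfOpenBookForm
import Literature.Geometry.Symplectic.LefschetzSteinRealisation
import Literature.Topology.FourManifolds.LefschetzModelFacts
import Summits.SmoothPoincare4.SmoothPoincare4.Theorems.ConvexBisectionAcyclicBisectionExistsStubSortBiSpan
import Summits.SmoothPoincare4.SmoothPoincare4.Theorems.ConvexBisectionAcyclicBisectionExistsStubReductionLift
import Literature.GroupTheory.CombinatorialGroupTheory.SignedHurwitzTravel
import Literature.GroupTheory.CombinatorialGroupTheory.SignedHurwitzExchange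
import HarnessLib

/-!
# `ConvexBisection.SteinBisectionExists` (item stmt-SmoothPoincare4-10509) and Baykur's theorem
# from the three Lefschetz-model facts of the crux programme

The support item `Summit.SmoothPoincare4.SmoothPoincare4.Theses.ConvexBisection.SteinBisectionExists`
is closed in the tree CONDITIONALLY on the single named fact
`Literature.Geometry.Symplectic.baykur_kahlerDecomposition` (R. İ. Baykur, *Kähler decomposition
of 4-manifolds*, Algebr. Geom. Topol. 6 (2006), Thm. 5.1; `steinBisectionExists_of_baykur`).  That
fact is XL and monolithic.  This file PROVES Baykur's §5 argument *structure* in the vocabulary of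
the tree: the fact — and with it the item — follows from the THREE smaller named facts over
one-sided Lefschetz models on which the crux line
`Cruxes/AcyclicBisectionExists/Lines/modp-braid-orbits.lean` of the same route already rests:

* `Literature.Topology.FourManifolds.LefschetzBase.modelsOnFibred_exists` — Etnyre–Fuller 2006,
  Thm. 1 / Prop. 12 with Baykur 2006, Lemma 1: every closed connected oriented smooth 4-manifold
  has an allowable fibred Lefschetz model `X = X(F_{g,1}; l) ∪_Ψ (F × D²)`;
* `Literature.Topology.FourManifolds.LefschetzBase.modelsOnFibred_of_reach` — Gompf–Stipsicz 1999,
  §8.2 / Baykur 2006, p. 13: fibred models are invariant under signed Hurwitz moves (and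
  stabilisation pairs);
* `Literature.Geometry.Symplectic.steinRealisation_of_sorted_modelsOnFibred` — Baykur 2006, proof
  of Thm. 5.1, pp. 13–14, with Loi–Piergallini / Akbulut–Ozbagci, Eliashberg, Gay: a SORTED fibred
  model realises `X = W₁ ∪_φ W₂` with both pieces compact Stein and ONE open book of the seam
  supporting both induced contact structures with the same orientation.

Every other step is proved in the tree: **sorting** by Hurwitz moves (Baykur 2006, p. 13: *"we
get a disk enclosing only positive critical points"* — re-choosing the arcs = Hurwitz moves;
here `exists_sorted_hurwitzOrbit_int` / `exists_sorted_reach`, from the landed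
`SortBiSpan.exists_sorted` over `ℚ`, the base-change lift `hurwitzOrbit_lift` and
`HurwitzOrbit.ne_zero`), open book ⇒ pointwise matching (`baykur_kahlerDecomposition_of_openBook`,
`ConvexBisectionSteinBisectionExistsOfOpenBookForm.lean`: Giroux, Gray, collar re-gluing), and the
item from the fact (`steinBisectionExists_of_baykur`).  So `baykur_kahlerDecomposition_holds`, and the item, land
the moment the three facts are discharged — the item carries no debt beyond the crux's.

## Main statements

* `exists_sorted_hurwitzOrbit_int`, `exists_sorted_reach` — every integral signed word reaches a
  sorted word at the same genus, all classes staying non-zero.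
* `kahlerDecomposition_openBook_of_lefschetzFacts` — the open-book rendering of Thm. 5.1 for every
  closed connected orientable smooth 4-manifold, from the three facts.
* `baykur_kahlerDecomposition_of_lefschetzFacts` — **the named fact from the three facts.**
* `steinBisectionExists_of_lefschetzFacts` — **the item from the three facts.**

No new definitions, no new named facts; the three facts enter as hypotheses (conditional results).

## References

* R. İ. Baykur, *Kähler decomposition of 4-manifolds*, Algebr. Geom. Topol. 6 (2006) 1239–1265,
  arXiv:math/0601396, Thm. 5.1, Lemma 1, pp. 12–14. [Baykur2006]
* J. B. Etnyre, T. Fuller, *Realizing 4-manifolds as achiral Lefschetz fibrations*, IMRN 2006,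
  Thm. 1, Prop. 12. [EtnyreFuller2006]
* R. E. Gompf, A. I. Stipsicz, *4-manifolds and Kirby calculus*, GSM 20 (1999), §8.2.
  [GompfStipsicz1999]
-/

noncomputable section

-- the prescribed namespace `Summit.<P>.<Sub>.…` duplicates `SmoothPoincare4` (P = Sub)
set_option linter.dupNamespace false

open scoped Manifold ContDiff Topology ContinuousMap
open Set Function
open Literature.Geometry.Symplectic Literature.Topology.FourManifolds
open Literature.Topology.FourManifolds.LefschetzBase
open Literature.GroupTheory.CombinatorialGroupTheory.SignedHurwitz

namespace Summit.SmoothPoincare4.SmoothPoincare4.Theorems.SteinBisection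

open Summit.SmoothPoincare4.SmoothPoincare4.Theses.ConvexBisection
open Summit.SmoothPoincare4.SmoothPoincare4.Theorems.AcyclicBisectionExists.ModpBraidOrbits

/-! ## Sorting a signed word by Hurwitz moves -/

/-- **Every integral signed word is carried to a sorted word** (positive letters first) by
signed Hurwitz moves for the standard alternating pairing at the same genus: sort the word read
over `ℚ` inside its Hurwitz orbit (`SortBiSpan.exists_sorted`: bubble each negative letter to the
back), lift the orbit to `ℤ` along `Int.castRingHom ℚ` (`hurwitzOrbit_lift`), and read off
sortedness through the coefficient change (`Sorted.of_mapWord`).  Baykur 2006, p. 13 (re-choosing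
the arcs of the capped fibration so that a disc encloses exactly the positive critical points).
[cite: Baykur2006, §5 p. 13] -/
theorem exists_sorted_hurwitzOrbit_int (g : ℕ) (l : IntWord g) :
    ∃ P N : IntWord g, HurwitzOrbit (stdSymp ℤ g) l (P ++ N) ∧ (∀ x ∈ P, x.2 = true) ∧
      ∀ x ∈ N, x.2 = false := by
  obtain ⟨P, N, hO, hP, hN, -⟩ := SortBiSpan.exists_sorted (stdSymp ℚ g) (ratWord l)
  have hO' : HurwitzOrbit (stdSymp ℚ g)
      (mapWord (fun (v : Fin g ⊕ Fin g → ℤ) i => Int.castRingHom ℚ (v i)) l) (P ++ N) := hO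
  obtain ⟨l', hl', hmap⟩ := hurwitzOrbit_lift (Int.castRingHom ℚ) g l hO'
  have hsorted : Sorted l' := by
    refine Sorted.of_mapWord (fun (v : Fin g ⊕ Fin g → ℤ) i => Int.castRingHom ℚ (v i)) ?_
    rw [hmap]
    exact ⟨P, N, rfl, hP, hN⟩
  obtain ⟨P', N', rfl, hP', hN'⟩ := hsorted
  exact ⟨P', N', hl', hP', hN'⟩

/-- **Every integral signed word reaches a sorted word** at the same genus (`Reach`: the move
calculus of the fibred-model facts), keeping all classes non-zero (a Hurwitz move for an
alternating pairing kills no class, `HurwitzOrbit.ne_zero`). [cite: Baykur2006, §5 p. 13] -/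
theorem exists_sorted_reach (g : ℕ) (l : IntWord g) (hl : ∀ x ∈ l, x.1 ≠ 0) :
    ∃ P N : IntWord g, Reach g l g (P ++ N) ∧ (∀ x ∈ P, x.2 = true) ∧ (∀ x ∈ N, x.2 = false) ∧
      ∀ x ∈ P ++ N, x.1 ≠ 0 := by
  obtain ⟨P, N, hO, hP, hN⟩ := exists_sorted_hurwitzOrbit_int g l
  exact ⟨P, N, Reach.of_hurwitzOrbit hO, hP, hN, hO.ne_zero (stdSymp_int_self g) hl⟩

/-! ## Baykur's Thm. 5.1 (open-book rendering) from the three Lefschetz-model facts -/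

/-- **Baykur 2006, Thm. 5.1, open-book rendering, from the three Lefschetz-model facts.**  For every
closed connected orientable smooth 4-manifold `X`: an allowable fibred model
(`modelsOnFibred_exists`), sorted by Hurwitz moves (`exists_sorted_reach`, the model persisting by
`modelsOnFibred_of_reach`, the classes staying non-zero), is realised
(`steinRealisation_of_sorted_modelsOnFibred`) as a gluing `X = W₁ ∪_φ W₂` of two compact Stein
domains with ONE open book of `∂W₁` carrying Giroux forms, of the same orientation, for both
induced seam contact structures. [cite: Baykur2006, Thm. 5.1 (proof, pp. 12–14)] -/
theorem kahlerDecomposition_openBook_of_lefschetzFacts (h₁ : modelsOnFibred_exists)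
    (h₂ : modelsOnFibred_of_reach) (h₃ : steinRealisation_of_sorted_modelsOnFibred) :
    ∀ (X : Type) [TopologicalSpace X] [T2Space X] [SecondCountableTopology X] [CompactSpace X]
      [ConnectedSpace X] [ChartedSpace (EuclideanSpace ℝ (Fin 4)) X] [IsManifold (𝓡 4) ∞ X],
      IsOrientable (𝓡 4) X →
      ∃ (W₁ : Type) (_ : TopologicalSpace W₁) (_ : ChartedSpace (EuclideanHalfSpace 4) W₁)
        (_ : IsManifold (𝓡∂ 4) ∞ W₁) (_ : CompactSpace W₁)
        (W₂ : Type) (_ : TopologicalSpace W₂) (_ : ChartedSpace (EuclideanHalfSpace 4) W₂)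
        (_ : IsManifold (𝓡∂ 4) ∞ W₂) (_ : CompactSpace W₂)
        (S₁ : SteinStructure W₁) (S₂ : SteinStructure W₂)
        (b₁ : BoundaryData (𝓡∂ 4) W₁ (𝓡 3)) (b₂ : BoundaryData (𝓡∂ 4) W₂ (𝓡 3))
        (φ : b₁.carrier ≃ₘ⟮𝓡 3, 𝓡 3⟯ b₂.carrier)
        (ob : OpenBook b₁.carrier) (α α' : Literature.Geometry.Kaehler.MForm (𝓡 3) b₁.carrier ℝ 1),
        IsBoundaryGluing b₁ b₂ φ (𝓡 4) X ∧
        ob.IsGirouxForm (boundaryPlaneField S₁.J b₁) α ∧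
        ob.IsGirouxForm (fun y => (boundaryPlaneField S₂.J b₂ (φ y)).comap
          (mfderiv (𝓡 3) (𝓡 3) φ y).toLinearMap) α' ∧
        ∀ y u v w, 0 < wedge₁₂ (α y) (Literature.Geometry.Kaehler.mextDeriv α y) u v w ↔
          0 < wedge₁₂ (α' y) (Literature.Geometry.Kaehler.mextDeriv α' y) u v w := by
  intro X _ _ _ _ _ _ _ hO
  -- Etnyre–Fuller / Baykur Lemma 1: an allowable fibred model
  obtain ⟨g, l, hnz, hmod⟩ := h₁ X hO
  -- Baykur p. 13: sort the word by Hurwitz moves; the model and the non-vanishing persist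
  obtain ⟨P, N, hreach, hP, hN, hnz'⟩ := exists_sorted_reach g l hnz
  have hmod' : ModelsOnFibred X g (P ++ N) := h₂ X g l g (P ++ N) hmod hreach
  -- Baykur pp. 13–14: Stein realisation of the sorted model with a common seam open book
  obtain ⟨W₁, t₁, c₁, m₁, k₁, _, _, W₂, t₂, c₂, m₂, k₂, S₁, S₂, b₁, b₂, φ, ob, α₁, α₂, hglue, hG₁,
    hG₂, hor, -⟩ := h₃ X g P N hmod' hP hN hnz'
  exact ⟨W₁, t₁, c₁, m₁, k₁, W₂, t₂, c₂, m₂, k₂, S₁, S₂, b₁, b₂, φ, ob, α₁, α₂, hglue, hG₁, hG₂, hor⟩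

/-- **The named fact `baykur_kahlerDecomposition` from the three Lefschetz-model facts** (Baykur
2006, Thm. 5.1 with its printed proof: Lemma 1 + sorting + Stein realisation give the open-book
rendering, `kahlerDecomposition_openBook_of_lefschetzFacts`; Giroux's uniqueness, Gray's stability
and collar re-gluing — all PROVED — turn it into the pointwise rendering,
`baykur_kahlerDecomposition_of_openBook`). [cite: Baykur2006, Thm. 5.1] -/
theorem baykur_kahlerDecomposition_of_lefschetzFacts (h₁ : modelsOnFibred_exists)
    (h₂ : modelsOnFibred_of_reach) (h₃ : steinRealisation_of_sorted_modelsOnFibred) :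
    baykur_kahlerDecomposition :=
  baykur_kahlerDecomposition_of_openBook (kahlerDecomposition_openBook_of_lefschetzFacts h₁ h₂ h₃)

/-- **`SteinBisectionExists` (item stmt-SmoothPoincare4-10509) from the three Lefschetz-model facts**
`modelsOnFibred_exists`, `modelsOnFibred_of_reach`, `steinRealisation_of_sorted_modelsOnFibred` —
the same named facts the crux line `modp-braid-orbits` of `AcyclicBisectionExists` leans on; every
other step (sorting, Giroux, Gray, collar re-gluing, the homotopy-sphere topology
`compactSpace_of_homotopyEquiv_sphere_four_holds` / `isOrientable_of_homotopyEquiv_sphere_four_holds`)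
is proved in the tree; composed through the fact itself (`baykur_kahlerDecomposition_of_lefschetzFacts`)
and the landed conditional closure `steinBisectionExists_of_baykur`. [cite: Baykur2006, Thm. 5.1] -/
theorem steinBisectionExists_of_lefschetzFacts (h₁ : modelsOnFibred_exists)
    (h₂ : modelsOnFibred_of_reach) (h₃ : steinRealisation_of_sorted_modelsOnFibred) :
    SteinBisectionExists :=
  steinBisectionExists_of_baykur (baykur_kahlerDecomposition_of_lefschetzFacts h₁ h₂ h₃)

end Summit.SmoothPoincare4.SmoothPoincare4.Theorems.SteinBisection

end
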